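import Mathlib.Analysis.Complex.ExponentialBounds
import Mathlib.Analysis.Real.Pi.Bounds

/-!
# `T4Continuum.ShellMeasureSmallnessArithmetic` — SM-L2 MADE KERNEL: END-II's smallness binders `1 < Rad` and
# (SM) `36·H∕(Rad − 1)² ≤ δ·θ` from a level-free modulus bound `H`, the RADIUS SCALING LAW `r₀∕θ ≤ Rad` and a
# THRESHOLD CEILING `θ ≤ min (r₀∕2) (δ·r₀²∕(144·H))`; the level-indexed «eventually in j» form; the level-0 currencies
(cell `pub-balaban`, sub-cell `t4`, spine estimate NE7c (node U5b); NE7c ROUND-2 crew `t4-ne7c-formalise-*`, seat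
`b2b-balaban-t4-ne7c-formalise-leaf-01`, OFFERED row «SM-L2 ARITHMETIC» of the claim table
`t4/b2b-balaban-t4-ne7c-p1/LEAVES-NE7c-P1.md` (the owner books ∕ renames ∕ refuses); ADDITIVE — imports Mathlib only;
0 `def`, 0 sorry, 0 citations; pure real arithmetic, every located input a displayed binder)

HONEST FRAMING.  Finite four-torus programme, rung (B)+1 only — NOT infinite volume, NOT a mass gap, NOT the Clay
problem, NOT summit progress.  NE7c = `T4IndicatorShell.ShellWeightBound` is NOT PRINTED in [Balaban 1983–89] and NOT
PROVED; «NE7c ⇐ the named binders» (trigger c3).  The skeleton's leaf SM-L2 («(SM)_j: 36·H∕(R − 1)² ≤ δ·θ_j — smallness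
of the interpolation modulus against the threshold; ARITHMETIC on SM-L1's constants; open iff SM-L1's numbers») is
the pair of END-II binders `(hRad : 1 < Rad)` and `(hSM : 36 * H ∕ (Rad − 1) ^ 2 ≤ δ * θ)` of
`ShellMeasureRootCompositionSU2.slotAC_realized_su2_of_levelData` (p207698; clean form in
`ShellMeasureRootCompositionSeam.slotAC_realized_su2_of_levelData_le`, p208381, and in `…LevelZero.…_cube`, p208890;
the v1 literal form carries `36 * H * 1 ^ 2 ∕ …`, typer T-NE7c-2).  Row S14 (`ShellMeasureMinimiserBonds`, p208432)
re-sourced SM-L1 so that, per slot, the (AN-bound) witness has a LEVEL-FREE modulus bound `H = e^{m·κ(ε₄+a)} − 1` on a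
disc of radius `Rad = a ∕ ‖𝔄₁‖` (`rayFamily_linear`), where `𝔄₁` is the background part of the contraction ray of a
window point `x`; the located READING is `‖𝔄₁‖ ≤ C·x₀` with the window radius `x₀ = c₀·M·θ_j` (the axial reach,
GAPS G-ne7cp1-13a) — i.e. a RADIUS SCALING LAW `Rad_j ≥ r₀ ∕ θ_j` with `r₀ = a ∕ (C·c₀·M)`.  THIS FILE proves the
arithmetic that turns (level-free `H`) + (radius scaling law, DISPLAYED as the binder `r₀ ∕ θ ≤ Rad`) + (threshold
ceiling `θ ≤ r₀∕2 ∧ 144·H·θ ≤ δ·r₀²`, DISPLAYED) into END-II's two binders LITERALLY, and the level-indexed form: under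
a ceiling holding for `j ≥ j₀` — in particular EVENTUALLY whenever the thresholds tend to `0` (a binder `Tendsto θ atTop
(𝓝 0)`, located, NOT asserted: which way Bałaban's thresholds `ε_j` move along the cell's level index is the owner's
reading, not this file's) — (SM)_j holds for all those levels.  Nothing is discharged: the scaling law, the ceiling and
`H` stay displayed; no `def … : Prop` (c2); no rate (c4).  HONEST DEPENDENCY (cell): continuum YM on T⁴ ⇐ BetaPertH ∧
nine spine estimates (0/9 proved); BetaPertH ⇐ (D1) ∧ (D4) ∧ CAP+tail; G-an2-4 gates asym, D1 and NE2/3/4.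

## What is proved (all [folklore] real arithmetic)

* §1 one level: `one_lt_of_radius_lower` (`0 < θ ≤ r₀∕2`, `r₀∕θ ≤ Rad` ⇒ `1 < Rad`), `half_radius_le_sub_one`
  (`r₀∕(2θ) ≤ Rad − 1`), **`sm_of_radius_lower`** (`0 ≤ H`, `0 < θ ≤ r₀∕2`, `144·H·θ ≤ δ·r₀²`, `r₀∕θ ≤ Rad` ⇒
  `36 * H ∕ (Rad − 1) ^ 2 ≤ δ * θ` — END-II's `hSM` LITERALLY), `sm_of_radius_lower'` (the v1 literal form with `1 ^ 2`),
  `sm_of_ceiling` (the two threshold conditions from ONE ceiling `θ ≤ min (r₀∕2) (δ·r₀²∕(144·H))`, `0 < H`).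
* §2 levels: `sm_levels_of_ceiling` (thresholds `θ_j`, radii `Rad_j ≥ r₀∕θ_j`, ceiling for `j ≥ j₀` ⇒ both binders for
  `j ≥ j₀`), **`sm_eventually_of_tendsto`** (`θ_j → 0` ⇒ both binders EVENTUALLY in `j`).
* §3 level-0 currencies: `sm0_of_window` ((SM)₀ ∕ (SM)_σ of `ShellMeasureWilsonRealizedSU2` ∕ `…GaugeInvariant`:
  `4·(8S)²·e^{16S} ≤ δ·θ` ⇐ `S ≤ 1∕16` ∧ `768·S² ≤ δ·θ`), `sm0_of_reach` (with the window∕threshold proportionality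
  `S ≤ c·θ` DISPLAYED: ⇐ `768·c²·θ ≤ δ`), `smE2_levelZero` (END-II currency at level 0, `H = e^{8·S·Rad} − 1`, with the
  choice `Rad = 1∕(8S)`: `0 < S ≤ 1∕16` ∧ `16128·S² ≤ δ·θ` ⇒ `1 < Rad` ∧ (SM) — a LOSSY sufficient condition; the
  optimum over `Rad` is ≈ `3557·S² ≤ δ·θ` at `8·S·Rad ≈ 1.594`, not kernel).

* §4 the numeric REGIME of the realized level-0 face (d = 4): `sq_window_le_of_smE2` ((SM) in END-II's currency ⇒
  `1152·S² ≤ δ·θ` for every `Rad`), **`window_lt_of_nonvacuous`** (reach + `ρ ≤ 1∕2` + (SM) + the NON-VACUITY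
  inequality `θ(1−ρ) < σ` ⇒ `S < δ∕(864π·m) < δ∕(2700·m)`), **`levelZero_regime_witness`** (explicit `S = 10⁻⁶`, `Rad = 1∕(8S)`,
  `σ = 2·10⁻⁷`, `θ = 4·10⁻⁸`, `δ = 1∕2`, `ρ = 1∕4`, `m = 1` meet EVERY numeric side condition of the level-0 face AND
  `θ(1−ρ) < σ` — jointly satisfiable with a live shell).

WHAT THIS DOES NOT DO.  It does not supply `H`, the scaling law or the ceiling for Bałaban's slots (SM-L1 ∕ the window
reading stay located); it asserts nothing about the direction of the thresholds or about which `S, σ, θ` Bałaban's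
level-0 step uses; (M1), NE7c NOT proved; 0/9 spine.
-/

open Filter Topology

namespace Summit.QuantumFields.BalabanUV.T4Continuum.ShellMeasureSmallnessArithmetic

/-! ## §1 One level: radius scaling law + threshold ceiling ⇒ END-II's `hRad` and `hSM` -/

section OneLevel

variable {H θ δ r₀ Rad : ℝ}

/-- a threshold at most half the radius constant forces the constant (hence the radius) positive. [folklore] -/
theorem radius_const_pos (hθ : 0 < θ) (hθr : θ ≤ r₀ / 2) : 0 < r₀ := by linarith

/-- **END-II's `hRad` FROM THE RADIUS SCALING LAW**: `0 < θ ≤ r₀∕2` and `r₀∕θ ≤ Rad` give `1 < Rad` (indeed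
`2 ≤ Rad`). [folklore] -/
theorem one_lt_of_radius_lower (hθ : 0 < θ) (hθr : θ ≤ r₀ / 2) (hRad : r₀ / θ ≤ Rad) : 1 < Rad := by
  have h2 : 2 ≤ r₀ / θ := by rw [le_div_iff₀ hθ]; linarith
  linarith

/-- under the scaling law and the half-radius ceiling the usable margin is at least `r₀∕(2θ)`: `r₀∕(2θ) ≤ Rad − 1`.
[folklore] -/
theorem half_radius_le_sub_one (hθ : 0 < θ) (hθr : θ ≤ r₀ / 2) (hRad : r₀ / θ ≤ Rad) :
    r₀ / (2 * θ) ≤ Rad - 1 := by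
  have h1 : 1 ≤ r₀ / (2 * θ) := by rw [le_div_iff₀ (by positivity)]; linarith
  have h2 : r₀ / (2 * θ) + r₀ / (2 * θ) = r₀ / θ := by field_simp; ring
  linarith

/-- **END-II's (SM) BINDER FROM THE RADIUS SCALING LAW AND THE THRESHOLD CEILING.**  A level-free modulus bound
`0 ≤ H`, a threshold `0 < θ` below the ceiling `θ ≤ r₀∕2 ∧ 144·H·θ ≤ δ·r₀²`, and an analyticity radius obeying the
scaling law `r₀∕θ ≤ Rad` give LITERALLY `36 * H ∕ (Rad − 1) ^ 2 ≤ δ * θ` (the clean `hSM` of END-II ∕ the seam's §3):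
`36H∕(Rad−1)² ≤ 36H·(2θ∕r₀)² = 144Hθ²∕r₀² ≤ δθ`. [folklore] -/
theorem sm_of_radius_lower (hH : 0 ≤ H) (hθ : 0 < θ) (hθr : θ ≤ r₀ / 2) (hθH : 144 * H * θ ≤ δ * r₀ ^ 2)
    (hRad : r₀ / θ ≤ Rad) : 36 * H / (Rad - 1) ^ 2 ≤ δ * θ := by
  have hr : 0 < r₀ := radius_const_pos hθ hθr
  have hm : r₀ / (2 * θ) ≤ Rad - 1 := half_radius_le_sub_one hθ hθr hRad
  have hmpos : 0 < r₀ / (2 * θ) := by positivity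
  have hsq : (r₀ / (2 * θ)) ^ 2 ≤ (Rad - 1) ^ 2 := by gcongr
  calc 36 * H / (Rad - 1) ^ 2 ≤ 36 * H / (r₀ / (2 * θ)) ^ 2 :=
        div_le_div_of_nonneg_left (by positivity) (by positivity) hsq
    _ = 144 * H * θ * θ / r₀ ^ 2 := by field_simp; ring
    _ ≤ δ * r₀ ^ 2 * θ / r₀ ^ 2 := by gcongr
    _ = δ * θ := by field_simp

/-- … the same in END-II v1's literal currency `36 * H * 1 ^ 2 ∕ (Rad − 1) ^ 2 ≤ δ * θ` (typer T-NE7c-2). [folklore] -/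
theorem sm_of_radius_lower' (hH : 0 ≤ H) (hθ : 0 < θ) (hθr : θ ≤ r₀ / 2) (hθH : 144 * H * θ ≤ δ * r₀ ^ 2)
    (hRad : r₀ / θ ≤ Rad) : 36 * H * 1 ^ 2 / (Rad - 1) ^ 2 ≤ δ * θ := by
  simpa only [one_pow, mul_one] using sm_of_radius_lower hH hθ hθr hθH hRad

/-- **BOTH BINDERS FROM ONE CEILING**: for `0 < H` the two threshold conditions are `θ ≤ min (r₀∕2) (δ·r₀²∕(144·H))`;
below that ceiling the scaling law gives `1 < Rad` and (SM). [folklore] -/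
theorem sm_of_ceiling (hH : 0 < H) (hθ : 0 < θ) (hceil : θ ≤ min (r₀ / 2) (δ * r₀ ^ 2 / (144 * H)))
    (hRad : r₀ / θ ≤ Rad) : 1 < Rad ∧ 36 * H / (Rad - 1) ^ 2 ≤ δ * θ := by
  have hθr : θ ≤ r₀ / 2 := hceil.trans (min_le_left _ _)
  have hθH' : θ ≤ δ * r₀ ^ 2 / (144 * H) := hceil.trans (min_le_right _ _)
  have hθH : 144 * H * θ ≤ δ * r₀ ^ 2 := by
    rw [le_div_iff₀ (by positivity)] at hθH'
    linarith
  exact ⟨one_lt_of_radius_lower hθ hθr hRad, sm_of_radius_lower hH.le hθ hθr hθH hRad⟩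

end OneLevel

/-! ## §2 Levels: the ceiling for `j ≥ j₀`; «eventually in j» from `θ_j → 0` -/

section Levels

variable {H δ r₀ : ℝ} {θ Rad : ℕ → ℝ}

/-- **(SM)_j FOR ALL LEVELS BEYOND `j₀`**: level-indexed thresholds `θ_j > 0` and radii obeying the scaling law
`r₀∕θ_j ≤ Rad_j`; if the ceiling `θ_j ≤ min (r₀∕2) (δ·r₀²∕(144·H))` holds for `j ≥ j₀`, then END-II's `hRad` and `hSM`
hold at every such level — with the SAME `H`, `δ` (K-uniformity displayed, not manufactured). [folklore] -/
theorem sm_levels_of_ceiling (hH : 0 < H) (hθ : ∀ j, 0 < θ j) (hRad : ∀ j, r₀ / θ j ≤ Rad j) {j₀ : ℕ}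
    (hceil : ∀ j, j₀ ≤ j → θ j ≤ min (r₀ / 2) (δ * r₀ ^ 2 / (144 * H))) :
    ∀ j, j₀ ≤ j → 1 < Rad j ∧ 36 * H / (Rad j - 1) ^ 2 ≤ δ * θ j :=
  fun j hj => sm_of_ceiling hH (hθ j) (hceil j hj) (hRad j)

/-- **(SM)_j EVENTUALLY IN `j`**: if moreover the thresholds tend to `0` (a located binder — NOT asserted here for
Bałaban's `ε_j`), the ceiling is eventually met (`0 < H`, `0 < δ`, `0 < r₀` make it positive), so END-II's `hRad` and
`hSM` hold for all sufficiently late levels. [folklore] -/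
theorem sm_eventually_of_tendsto (hH : 0 < H) (hδ : 0 < δ) (hr : 0 < r₀) (hθ : ∀ j, 0 < θ j)
    (hRad : ∀ j, r₀ / θ j ≤ Rad j) (hlim : Tendsto θ atTop (𝓝 0)) :
    ∀ᶠ j in atTop, 1 < Rad j ∧ 36 * H / (Rad j - 1) ^ 2 ≤ δ * θ j := by
  have hpos : (0 : ℝ) < min (r₀ / 2) (δ * r₀ ^ 2 / (144 * H)) := lt_min (by positivity) (by positivity)
  filter_upwards [hlim.eventually_lt_const hpos] with j hj
  exact sm_of_ceiling hH (hθ j) hj.le (hRad j)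

end Levels

/-! ## §3 The level-0 currencies -/

section LevelZero

variable {S θ δ c : ℝ}

/-- `e^{16S} ≤ 3` for `S ≤ 1∕16` (from `e < 2.7182818286`). [folklore] -/
theorem exp_sixteen_mul_le_three (hS : S ≤ 1 / 16) : Real.exp (2 * (8 * S)) ≤ 3 := by
  have h1 : Real.exp (2 * (8 * S)) ≤ Real.exp 1 := Real.exp_le_exp.2 (by linarith)
  have h2 := Real.exp_one_lt_d9
  linarith

/-- **(SM)₀ ∕ (SM)_σ IN THE LEVEL-0 CURRENCY** of `ShellMeasureWilsonRealizedSU2.slotAntiConcentration_wilson_su2`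
(p206694) ∕ `ShellMeasureWilsonGaugeInvariant.…_gaugeInvariant` (p207446) — `4·(8S)²·e^{2·(8S)} ≤ δ·θ` — from the
window bound `S ≤ 1∕16` and the quadratic condition `768·S² ≤ δ·θ`. [folklore] -/
theorem sm0_of_window (hS : S ≤ 1 / 16) (h : 768 * S ^ 2 ≤ δ * θ) :
    4 * (8 * S) ^ 2 * Real.exp (2 * (8 * S)) ≤ δ * θ := by
  have he := exp_sixteen_mul_le_three hS
  have hsq : 0 ≤ 4 * (8 * S) ^ 2 := by positivity
  calc 4 * (8 * S) ^ 2 * Real.exp (2 * (8 * S)) ≤ 4 * (8 * S) ^ 2 * 3 := by gcongr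
    _ = 768 * S ^ 2 := by ring
    _ ≤ δ * θ := h

/-- **(SM)₀ UNDER THE WINDOW∕THRESHOLD PROPORTIONALITY** (the located reading «chart window = axial reach ∝ θ₀»,
DISPLAYED as `S ≤ c·θ`): `0 ≤ S ≤ 1∕16`, `S ≤ c·θ` with `0 ≤ θ`, and `768·c²·θ ≤ δ` give (SM)₀ — i.e. (SM)₀
holds for every threshold below `δ∕(768c²)`. [folklore] -/
theorem sm0_of_reach (hS0 : 0 ≤ S) (hS : S ≤ 1 / 16) (hθ : 0 ≤ θ) (hSc : S ≤ c * θ)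
    (h : 768 * c ^ 2 * θ ≤ δ) : 4 * (8 * S) ^ 2 * Real.exp (2 * (8 * S)) ≤ δ * θ := by
  refine sm0_of_window hS ?_
  calc 768 * S ^ 2 ≤ 768 * (c * θ) ^ 2 := by gcongr
    _ = 768 * c ^ 2 * θ * θ := by ring
    _ ≤ δ * θ := by gcongr

/-- **END-II's CURRENCY AT LEVEL 0** (`ShellMeasureRootCompositionLevelZero.slotAntiConcentration_wilson_su2_gaugeInvariant
_of_levelData`, p208890: `hRad : 1 < Rad`, `hSM : 36·(e^{8·S·Rad} − 1)∕(Rad − 1)² ≤ δ·θ`, `Rad` free) with the CHOICE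
`Rad = 1∕(8S)`: `0 < S ≤ 1∕16` and `16128·S² ≤ δ·θ` suffice (`e^{8S·Rad} − 1 = e − 1 ≤ 7∕4`, `Rad − 1 ≥ 1∕(16S)`).  A
LOSSY sufficient condition (the optimum over `Rad` is ≈ `3557·S² ≤ δ·θ` at `8·S·Rad ≈ 1.594`; not kernel).
[folklore] -/
theorem smE2_levelZero (hS0 : 0 < S) (hS : S ≤ 1 / 16) (h : 16128 * S ^ 2 ≤ δ * θ) :
    1 < 1 / (8 * S) ∧ 36 * (Real.exp (8 * S * (1 / (8 * S))) - 1) / (1 / (8 * S) - 1) ^ 2 ≤ δ * θ := by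
  have h8 : 0 < 8 * S := by positivity
  have hRad1 : 8 * S * (1 / (8 * S)) = 1 := by field_simp
  have hmargin : 1 / (16 * S) ≤ 1 / (8 * S) - 1 := by
    rw [div_le_iff₀ (by positivity : (0 : ℝ) < 16 * S)]
    have : (1 / (8 * S) - 1) * (16 * S) = 2 - 16 * S := by field_simp; ring
    rw [this]; linarith
  have hone : 1 < 1 / (8 * S) := by
    rw [lt_div_iff₀ h8]; linarith
  refine ⟨hone, ?_⟩
  have hmpos : 0 < 1 / (16 * S) := by positivity
  have hsq : (1 / (16 * S)) ^ 2 ≤ (1 / (8 * S) - 1) ^ 2 := by gcongr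
  have hnum : Real.exp (8 * S * (1 / (8 * S))) - 1 ≤ 7 / 4 := by
    rw [hRad1]; have := Real.exp_one_lt_d9; linarith
  have hnum0 : 0 ≤ Real.exp (8 * S * (1 / (8 * S))) - 1 := by
    rw [hRad1]; have := Real.add_one_le_exp (1 : ℝ); linarith
  calc 36 * (Real.exp (8 * S * (1 / (8 * S))) - 1) / (1 / (8 * S) - 1) ^ 2
      ≤ 36 * (7 / 4) / (1 / (16 * S)) ^ 2 := by
        calc 36 * (Real.exp (8 * S * (1 / (8 * S))) - 1) / (1 / (8 * S) - 1) ^ 2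
            ≤ 36 * (Real.exp (8 * S * (1 / (8 * S))) - 1) / (1 / (16 * S)) ^ 2 :=
              div_le_div_of_nonneg_left (by positivity) (by positivity) hsq
          _ ≤ 36 * (7 / 4) / (1 / (16 * S)) ^ 2 := by gcongr
    _ = 16128 * S ^ 2 := by field_simp; ring
    _ ≤ δ * θ := h

end LevelZero

/-! ## §4 The numeric REGIME of the realized level-0 face (d = 4): a necessary window bound and a non-vacuous witness -/

section Regime

variable {S σ θ δ ρ Rad : ℝ} {m : ℕ}

/-- **(SM) IN END-II's LEVEL-0 CURRENCY FORCES `1152·S² ≤ δ·θ`** — for EVERY radius: `1 < Rad` and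
`36·(e^{8·S·Rad} − 1)∕(Rad − 1)² ≤ δ·θ` with `0 ≤ S` give `1152·S² ≤ δ·θ` (`e^x − 1 ≥ x²∕2` and `Rad∕(Rad − 1) ≥ 1`).
The interpolation-modulus route costs a SQUARE of the window in the threshold. [folklore] -/
theorem sq_window_le_of_smE2 (hS : 0 ≤ S) (hRad : 1 < Rad)
    (hSM : 36 * (Real.exp (8 * S * Rad) - 1) / (Rad - 1) ^ 2 ≤ δ * θ) : 1152 * S ^ 2 ≤ δ * θ := by
  have hR1 : 0 < Rad - 1 := by linarith
  have hx : 0 ≤ 8 * S * Rad := by nlinarith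
  have hexp : (8 * S * Rad) ^ 2 / 2 ≤ Real.exp (8 * S * Rad) - 1 := by
    have := Real.quadratic_le_exp_of_nonneg hx
    linarith
  have hratio : (1 : ℝ) ≤ Rad ^ 2 / (Rad - 1) ^ 2 := by
    rw [le_div_iff₀ (by positivity)]
    nlinarith
  calc 1152 * S ^ 2 = 36 * ((8 * S) ^ 2 / 2) * 1 := by ring
    _ ≤ 36 * ((8 * S) ^ 2 / 2) * (Rad ^ 2 / (Rad - 1) ^ 2) := by gcongr
    _ = 36 * ((8 * S * Rad) ^ 2 / 2) / (Rad - 1) ^ 2 := by field_simp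
    _ ≤ 36 * (Real.exp (8 * S * Rad) - 1) / (Rad - 1) ^ 2 := by gcongr
    _ ≤ δ * θ := hSM

/-- **NECESSARY WINDOW BOUND FOR A NON-VACUOUS LEVEL-0 FACE (d = 4).**  In
`ShellMeasureRootCompositionLevelZero.slotAntiConcentration_wilson_su2_gaugeInvariant_of_levelData` (p208890) the
realized density restricts every box plaquette to `dist1 < σ` while the classifier `u = max_{P_u ⊆ box} dist1` is
tested on the shell `{θ(1 − ρ) ≤ u < θ}`: the shell meets the support only if `θ(1 − ρ) < σ` (DISPLAYED here as the
non-vacuity binder `hne`).  Together with the reach condition `3·m·σ ≤ 2S∕π` (`d − 1 = 3`, box side `m ≥ 1`),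
`ρ ≤ 1∕2` (from `ρ ≤ (1−δ)∕2`), `0 < δ` and (SM) in END-II's currency, this forces `S < δ ∕ (864·π·m)`
(`< δ∕(2700·m)`, primed twin): a non-vacuous instance lives only in a window three orders of magnitude below the chart
bound `S ≤ 1∕8`.  Pure arithmetic on the
displayed side conditions; nothing about Bałaban's constants is asserted. [folklore] -/
theorem window_lt_of_nonvacuous (hS : 0 ≤ S) (hδ : 0 < δ) (hm : 1 ≤ m) (hθ : 0 < θ) (hρ : ρ ≤ 1 / 2)
    (hRad : 1 < Rad) (hSM : 36 * (Real.exp (8 * S * Rad) - 1) / (Rad - 1) ^ 2 ≤ δ * θ)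
    (hrad : (3 : ℝ) * m * σ ≤ 2 * S / Real.pi) (hne : θ * (1 - ρ) < σ) : S < δ / (864 * Real.pi * m) := by
  have hsq : 1152 * S ^ 2 ≤ δ * θ := sq_window_le_of_smE2 hS hRad hSM
  have hm' : (1 : ℝ) ≤ m := by exact_mod_cast hm
  have hπ := Real.pi_gt_three
  have hπ' := Real.pi_lt_d2
  have hθσ : θ / 2 < σ := by nlinarith
  -- σ ≤ 2S/(3πm): from hrad
  have hσ : σ ≤ 2 * S / (3 * Real.pi * m) := by
    rw [le_div_iff₀ (by positivity)]
    have h := hrad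
    rw [le_div_iff₀ (by positivity)] at h
    nlinarith
  -- hence θ < 4S/(3πm) and S > 0
  have hθS : θ < 4 * S / (3 * Real.pi * m) := by
    have : 4 * S / (3 * Real.pi * m) = 2 * (2 * S / (3 * Real.pi * m)) := by ring
    linarith
  have hSpos : 0 < S := by
    by_contra h
    have hS0 : S = 0 := le_antisymm (not_lt.1 h) hS
    rw [hS0] at hθS
    simp at hθS
    linarith
  -- 1152 S² ≤ δθ < 4δS/(3πm) ⇒ 1152 S < 4δ/(3πm) ⇒ S < δ/(864πm)
  have h1 : 1152 * S ^ 2 < δ * (4 * S / (3 * Real.pi * m)) := by nlinarith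
  have h2 : 1152 * S < 4 * δ / (3 * Real.pi * m) := by
    have h3 : δ * (4 * S / (3 * Real.pi * m)) = (4 * δ / (3 * Real.pi * m)) * S := by ring
    rw [h3] at h1
    nlinarith
  rw [lt_div_iff₀ (by positivity)]
  rw [lt_div_iff₀ (by positivity)] at h2
  nlinarith

/-- … in decimals: `S < δ ∕ (2700·m)` (`864·π > 2700`). [folklore] -/
theorem window_lt_of_nonvacuous' (hS : 0 ≤ S) (hδ : 0 < δ) (hm : 1 ≤ m) (hθ : 0 < θ) (hρ : ρ ≤ 1 / 2)
    (hRad : 1 < Rad) (hSM : 36 * (Real.exp (8 * S * Rad) - 1) / (Rad - 1) ^ 2 ≤ δ * θ)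
    (hrad : (3 : ℝ) * m * σ ≤ 2 * S / Real.pi) (hne : θ * (1 - ρ) < σ) : S < δ / (2700 * m) := by
  have h := window_lt_of_nonvacuous hS hδ hm hθ hρ hRad hSM hrad hne
  have hm' : (0 : ℝ) < m := by exact_mod_cast Nat.lt_of_lt_of_le Nat.zero_lt_one hm
  have hπ := Real.pi_gt_d2
  refine h.trans_le (div_le_div_of_nonneg_left hδ.le (by positivity) ?_)
  nlinarith

/-- **A NON-VACUOUS WITNESS OF THE LEVEL-0 REGIME (d = 4, box side `m = 1`)**: window `S = 10⁻⁶`, radius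
`Rad = 1∕(8S)`, box threshold `σ = 2·10⁻⁷`, classifier threshold `θ = 4·10⁻⁸`, `δ = 1∕2`, width `ρ = 1∕4` satisfy
EVERY numeric side condition of `…_gaugeInvariant_of_levelData` (p208890) — `0 < S ≤ 1∕8`, `3S² < π²`, `0 < σ`, reach
`3·1·σ ≤ 2S∕π`, `0 < θ`, `0 ≤ δ < 1`, `0 ≤ ρ ≤ (1−δ)∕2`, `1 < Rad`, (SM) in END-II's currency, (SM)_σ — AND the
non-vacuity inequality `θ(1 − ρ) < σ` (indeed `θ < σ`: the whole shell lies inside the box co-test).  So the side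
conditions are JOINTLY SATISFIABLE with a live shell; by `window_lt_of_nonvacuous` no witness has `S ≥ δ∕(864π)`.
[folklore] -/
theorem levelZero_regime_witness :
    (0 : ℝ) < 1 / 10 ^ 6 ∧ (1 / 10 ^ 6 : ℝ) ≤ 1 / 8 ∧ 3 * (1 / 10 ^ 6 : ℝ) ^ 2 < Real.pi ^ 2 ∧
    (0 : ℝ) < 2 / 10 ^ 7 ∧ ((4 - 1 : ℕ) : ℝ) * (1 : ℕ) * (2 / 10 ^ 7 : ℝ) ≤ 2 * (1 / 10 ^ 6) / Real.pi ∧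
    (0 : ℝ) < 4 / 10 ^ 8 ∧ (0 : ℝ) ≤ 1 / 2 ∧ (1 / 2 : ℝ) < 1 ∧ (0 : ℝ) ≤ 1 / 4 ∧ (1 / 4 : ℝ) ≤ (1 - 1 / 2) / 2 ∧
    1 < 1 / (8 * (1 / 10 ^ 6 : ℝ)) ∧
    36 * (Real.exp (8 * (1 / 10 ^ 6 : ℝ) * (1 / (8 * (1 / 10 ^ 6)))) - 1) / (1 / (8 * (1 / 10 ^ 6)) - 1) ^ 2 ≤
      (1 / 2) * (4 / 10 ^ 8) ∧
    4 * (8 * (1 / 10 ^ 6 : ℝ)) ^ 2 * Real.exp (2 * (8 * (1 / 10 ^ 6))) ≤ (1 / 2) * (2 / 10 ^ 7) ∧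
    (4 / 10 ^ 8 : ℝ) * (1 - 1 / 4) < 2 / 10 ^ 7 := by
  have hπ := Real.pi_gt_three
  have hπ' := Real.pi_lt_d2
  refine ⟨by norm_num, by norm_num, by nlinarith, by norm_num, ?_, by norm_num, by norm_num, by norm_num, by norm_num,
    by norm_num, ?_, ?_, ?_, by norm_num⟩
  · rw [le_div_iff₀ (by positivity)]
    push_cast
    nlinarith
  · exact (smE2_levelZero (S := 1 / 10 ^ 6) (δ := 1 / 2) (θ := 4 / 10 ^ 8) (by norm_num) (by norm_num)
      (by norm_num)).1
  · exact (smE2_levelZero (S := 1 / 10 ^ 6) (δ := 1 / 2) (θ := 4 / 10 ^ 8) (by norm_num) (by norm_num)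
      (by norm_num)).2
  · exact sm0_of_window (by norm_num) (by norm_num)

end Regime

end Summit.QuantumFields.BalabanUV.T4Continuum.ShellMeasureSmallnessArithmetic
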